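import Summits.CriticalPhenomena.PercolationContinuityZ3.Theorems.PercNearOneGluingNoHeavyLowerTailSahiCombSubstitution

/-!
# Block substitution AT EVERY ORDER — monotone functions of independent block events inherit Sahi / comb positivity of every order
# from the small cube of patterns

Support file (cell `prim-sahi`, seat `prim-sahi-typer` gen 36; `--supports stmt-CriticalPhenomena-4575`).  Pure proofs, no definitions, no
named facts, no `sorry`, standard axioms.  The order-`3` case is P3's `SahiCombSubstitution.combPos_sahiE_three_subst`
(`…SahiCombSubstitution`); nothing in that argument used `n = 3`, and this file records the all-orders form, which the five-letter
all-orders certificate (`SahiCombFive.combPos_sahiE_of_card_le_five_all`, `…SahiCombCubeFiveAllOrders`) and the six-letter order-`3` certificate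
(`…ThreePartitionCubeSix`) instantiate in the companion files `…SahiCombSubstitutionFiveAllOrders` / `…SahiCombSixLetterStrata`.

Setting (as in `…SahiCombSubstitution`): `r` events `X_0,…,X_{r−1} ⊆ 2^ι` determined by PAIRWISE DISJOINT coordinate sets `S_j`, the bit vector
`bits X ω = {j | ω ∈ X_j}`, whose law under the product weight `μ_p` is the product weight on `2^{Fin r}` with the block parameters
`x_j(p) = μ_p(X_j)` (`pushWeight_bits`).
* `sahiE_comp_bits` — for EVERY order `n` and all `f_i : 2^{Fin r} → ℝ`: `E_n(μ_p; f_0 ∘ bits,…,f_{n−1} ∘ bits) = E_n(μ_{x(p)}; f_0,…,f_{n−1})`;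
* `sahiE_comp_bits_nonneg_of_sahiPositive` — value level: Sahi positivity of order `n` of the block-parameter weight on the pattern cube gives
  `E_n ≥ 0` for every family of nonnegative monotone functions of the bit vector (the `X_j` need not even be increasing);
* `sum_block_degree_le_of_pairwiseDisjoint` — the block multidegrees `n·1_{S_j}` add up to at most `n`;
* **`combPos_sahiE_subst`** — comb level, every order `n`: if `p ↦ E_n(μ_p; 1_{Φ_0},…,1_{Φ_{n−1}})` is comb-positive of multidegree `n` on the
  cube `Fin r`, then `p ↦ E_n(μ_p; 1_{subst X Φ_0},…)` is comb-positive of multidegree `n` on `ι` (substitute the `S_j`-supported comb-positive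
  block probabilities `x_j(p)`, `1 − x_j(p)` into the nonnegative tensor-Bernstein representation).
HONEST LABEL: transfer statements only; they assert no positivity by themselves. [this work]
-/

noncomputable section

open scoped Classical

namespace Summit.CriticalPhenomena.PercolationContinuityZ3.Theorems

namespace SahiCombSubstitution

open Finset Function
open Literature.Combinatorics.Sahi2008
open Literature.Probability.Percolation (DeterminedBy)
open Literature.Probability.Percolation.DecisionTree (ind ind_nonneg)
open SahiComb

variable {ι : Type} [Fintype ι] {r : ℕ}

/-! ### Value level, every order -/

/-- **`E_n` of functions of the bit vector is `E_n` on the pattern cube under the block-parameter product weight**, every order `n`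
(`sahiE_subst` is the case of pattern indicators). [this work] -/
theorem sahiE_comp_bits (p : ι → unitInterval) (X : Fin r → Set (Set ι)) (S : Fin r → Finset ι)
    (hS : (Set.univ : Set (Fin r)).PairwiseDisjoint S) (hXd : ∀ j, DeterminedBy (X j) (↑(S j) : Set ι)) (n : ℕ)
    (f : Fin n → Set (Fin r) → ℝ) :
    sahiE (bernoulliWeight p) n (fun i => f i ∘ bits X) = sahiE (bernoulliWeight (blockParam p X)) n f := by
  rw [← pushWeight_bits p X S hS hXd, sahiE_pushWeight]

/-- **Value-level substitution at order `n`**: if the block-parameter product weight on `2^{Fin r}` is Sahi-positive of order `n`, then every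
family of `n` nonnegative monotone functions of the bit vector of `r` events with pairwise disjoint supports has `E_n(μ_p) ≥ 0`. [this work] -/
theorem sahiE_comp_bits_nonneg_of_sahiPositive (p : ι → unitInterval) (X : Fin r → Set (Set ι)) (S : Fin r → Finset ι)
    (hS : (Set.univ : Set (Fin r)).PairwiseDisjoint S) (hXd : ∀ j, DeterminedBy (X j) (↑(S j) : Set ι)) {n : ℕ}
    (hpos : SahiPositive (bernoulliWeight (blockParam p X)) n) (f : Fin n → Set (Fin r) → ℝ) (hf0 : ∀ i η, 0 ≤ f i η)
    (hfm : ∀ i, Monotone (f i)) : 0 ≤ sahiE (bernoulliWeight p) n (fun i => f i ∘ bits X) := by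
  rw [sahiE_comp_bits p X S hS hXd n f]
  exact hpos f hf0 hfm

/-- Pattern events, value level, order `n`: `E_n(μ_p; 1_{subst X Φ_0},…) ≥ 0` from Sahi positivity of order `n` of the block-parameter weight
and increasing patterns. [this work] -/
theorem sahiE_subst_nonneg_of_sahiPositive (p : ι → unitInterval) (X : Fin r → Set (Set ι)) (S : Fin r → Finset ι)
    (hS : (Set.univ : Set (Fin r)).PairwiseDisjoint S) (hXd : ∀ j, DeterminedBy (X j) (↑(S j) : Set ι)) {n : ℕ}
    (hpos : SahiPositive (bernoulliWeight (blockParam p X)) n) (Φ : Fin n → Set (Set (Fin r))) (hΦ : ∀ i, IsUpperSet (Φ i)) :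
    0 ≤ sahiE (bernoulliWeight p) n (fun i => ind (subst X (Φ i))) := by
  rw [sahiE_subst p X S hS hXd n Φ]
  exact hpos _ (fun i η => ind_nonneg _ _) (fun i => monotone_ind_of_isUpperSet (hΦ i))

/-! ### Comb level, every order -/

omit [Fintype ι] in
/-- With pairwise disjoint blocks, the block multidegrees `n·1_{S_j}` add up to at most `n`. [this work] -/
theorem sum_block_degree_le_of_pairwiseDisjoint (n : ℕ) (S : Fin r → Finset ι) (hS : (Set.univ : Set (Fin r)).PairwiseDisjoint S)
    (e : ι) : (∑ j : Fin r, if e ∈ S j then n else 0) ≤ n := by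
  by_cases h : ∃ j, e ∈ S j
  · obtain ⟨j₀, hj₀⟩ := h
    have hothers : ∀ j, j ≠ j₀ → e ∉ S j := fun j hj he =>
      Finset.disjoint_left.1 (hS (Set.mem_univ j) (Set.mem_univ j₀) hj) he hj₀
    rw [Finset.sum_eq_single j₀ (fun j _ hj => by rw [if_neg (hothers j hj)]) (fun h => absurd (Finset.mem_univ _) h), if_pos hj₀]
  · simp only [not_exists] at h
    rw [Finset.sum_eq_zero fun j _ => by rw [if_neg (h j)]]
    exact Nat.zero_le _

/-- **Block substitution at every order.**  If the patterns' `E_n` is comb-positive of multidegree `n` on the cube `Fin r`, then `E_n` of the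
substituted events is comb-positive of multidegree `n` on `ι` (pairwise disjoint supports; the `X_j` need not be increasing for this transfer).
[this work] -/
theorem combPos_sahiE_subst (n : ℕ) (X : Fin r → Set (Set ι)) (S : Fin r → Finset ι)
    (hS : (Set.univ : Set (Fin r)).PairwiseDisjoint S) (hXd : ∀ j, DeterminedBy (X j) (↑(S j) : Set ι)) (Φ : Fin n → Set (Set (Fin r)))
    (h : CombPos (fun _ : Fin r => n) (fun q => sahiE (bernoulliWeight q) n (fun i => ind (Φ i)))) :
    CombPos (fun _ : ι => n) (fun p => sahiE (bernoulliWeight p) n (fun i => ind (subst X (Φ i)))) := by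
  obtain ⟨N, hN, hrep⟩ := h
  -- each basis function of the block parameters is comb-positive with multidegree `Σ_j n·1_{S_j}`
  have hfac : ∀ k : Fin r → ℕ, k ∈ box (fun _ : Fin r => n) → CombPos (fun e => ∑ j : Fin r, if e ∈ S j then n else 0)
      (fun p => bern (fun _ : Fin r => n) k (blockParam p X)) := by
    intro k hk
    have hkj : ∀ j, k j ≤ n := fun j => mem_box.1 hk j
    have hj : ∀ j ∈ (Finset.univ : Finset (Fin r)), CombPos (fun e => if e ∈ S j then n else 0)
        (fun p => (ex (bernoulliWeight p) (ind (X j))) ^ (k j) * (1 - ex (bernoulliWeight p) (ind (X j))) ^ (n - k j)) := by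
      intro j _
      have h1 := (CombPos.pow (combPos_ex_ind_supported (S j) (hXd j)) (k j)).mul
        (CombPos.pow (combPos_one_sub_ex_ind_supported (S j) (hXd j)) (n - k j))
      refine (show ((fun e => k j * (if e ∈ S j then 1 else 0)) + fun e => (n - k j) * (if e ∈ S j then 1 else 0)) =
          fun e => if e ∈ S j then n else 0 from ?_) ▸ h1
      funext e
      simp only [Pi.add_apply]
      have := hkj j
      by_cases he : e ∈ S j
      · simp [he]; omega
      · simp [he]
    refine (CombPos.finset_prod Finset.univ hj).congr fun p => ?_
    unfold bern
    rfl
  have hterm : ∀ k ∈ box (fun _ : Fin r => n), CombPos (fun _ : ι => n)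
      (fun p => N k * bern (fun _ : Fin r => n) k (blockParam p X)) := fun k hk =>
    (((hfac k hk).mono fun e => sum_block_degree_le_of_pairwiseDisjoint n S hS e).smul (hN k)).congr fun p => by ring
  refine (CombPos.sum _ hterm).congr fun p => ?_
  rw [sahiE_subst p X S hS hXd n Φ]
  exact hrep (blockParam p X)

/-- **Every order from an all-orders cube hypothesis**: if EVERY family of increasing patterns on the cube `Fin r` has comb-positive `E_n`
(multidegree `n`) for every `n`, then so does every substituted family, in every dimension. [this work] -/
theorem combPos_sahiE_subst_of_forall (hcube : ∀ (n : ℕ) (Ψ : Fin n → Set (Set (Fin r))), (∀ i, IsUpperSet (Ψ i)) →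
      CombPos (fun _ : Fin r => n) (fun q => sahiE (bernoulliWeight q) n (fun i => ind (Ψ i))))
    (X : Fin r → Set (Set ι)) (S : Fin r → Finset ι) (hS : (Set.univ : Set (Fin r)).PairwiseDisjoint S)
    (hXd : ∀ j, DeterminedBy (X j) (↑(S j) : Set ι)) (n : ℕ) (Φ : Fin n → Set (Set (Fin r))) (hΦ : ∀ i, IsUpperSet (Φ i)) :
    CombPos (fun _ : ι => n) (fun p => sahiE (bernoulliWeight p) n (fun i => ind (subst X (Φ i)))) :=
  combPos_sahiE_subst n X S hS hXd Φ (hcube n Φ hΦ)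

end SahiCombSubstitution

end Summit.CriticalPhenomena.PercolationContinuityZ3.Theorems
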